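import Summits.QuantumFields.BalabanUV.Beta.EriceFlowEnclosureB12AsPrintedPointwiseWitness

/-!
# Beta / EriceFlowEnclosureB12AsPrintedPointwiseUniformIff — WHAT (0.31) FORCES POINTWISE, part 3: IN THE MARKOV READING WITH INJECTIVE ONE-STEP MAPS,
# [I] THEOREM 2 WITH g-UNIFORM CONSTANTS ⟺ THE POINTWISE AF LETTER.  The converse of part 2's `letters_of_uniformTheorem2_markov` on the as-printed carrier:
# the letters (AF) `BetaLowerH b`, (U) `BetaUpperH b′`, (C) `BetaContH` on a box + the printed `Definitions` give the g-UNIFORM cpl-form of (0.31) with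
# β = b∕ln L, β′ = b′∕ln L (prover 1's shooting `FlowStep.couplingTrajectory_exists_hist` identified with the setting's runs by `cpl_eq_of_rgEqH`); hence, under
# Markov + injectivity + `hrg` + a bound + (C), the uniform-constant Theorem 2 and «∃ box with 0 < b ≤ β_{k+1} ≤ b′» are EQUIVALENT BY NAME (β-flow team, prover 2
# = lower ∕ positivity side, unit `b2b-balaban-beta-bflow-p2`, gen 42; ROW AP-I × ROW U; parts 1–2 `…B12AsPrintedPointwise` ∕ `…PointwiseUniform`; witnesses
# `…PointwiseDip ∕ …PointwiseWitness ∕ …PointwiseSizeWitness`)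

HONEST FRAMING (page 1 of everything the β sub-cell writes): discharging `BetaPertH` makes Bałaban's UV stability UNCONDITIONAL — a
real constructive-QFT result; it is NOT the continuum limit and NOT the Clay problem.  HONEST DEPENDENCY (cell reorg 2026-08-19,
verbatim): «continuum YM on T⁴ ⇐ BetaPertH ∧ nine spine estimates (0/9 proved); BetaPertH ⇐ (D1) ∧ (D4) ∧ CAP+tail; G-an2-4 gates
asym, D1 and NE2/3/4.»  THIS MODULE DISCHARGES NOTHING: bookkeeping from the NAMED FIELDS of `B12BetaAsPrinted` ([Balaban1987RG1] as typed, p537882 ✓ ∕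
v1.1–v1.3; `Definitions` d018∕d020; Theorem 2 STATED WITHOUT PROOF, p. 259) under LETTERS that are HYPOTHESES on an abstract `Setting S` — the cell's located
UNPRINTED inputs (AF) `FlowStep.BetaLowerH b` (b > 0), (U) `BetaUpperH b′`, (C) `BetaContH` (DELTA-I D-20: not printed for the preceding couplings), the Markov
letter `hM`, injectivity of the one-step maps (row U; uniqueness of g₀ is NOT printed — DELTA-I D-21), prover 1's binder `hrg` — and ONE READING, `hTu` = (0.31)
with «there exist constants β, β′» read BEFORE «for a sufficiently small positive g» (cpl-form; the tree's `Missing.B12Thm2Shape` has them after g).  Nothing of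
Bałaban's objects is asserted.

WHAT THIS FILE PROVES (0 sorry, 0 def):
§7 **`uniformTheorem2_of_letters`** — `Definitions` + (C)+(AF b)+(U b′) on ]0, γ₀]^{k+1} (0 < b ≤ b′) ⟹ the g-UNIFORM cpl-form `hTu` with γ₀, g₁ := γ, β := b∕ln L,
   β′ := b′∕ln L, AND `Theorem2Statement S hL` (the typed reading; = prover 1's `theorem2Statement_of_letters` by another proof) — both readings follow from the
   letters with the SAME constants.
§8 **`uniformTheorem2_iff_afLetters_markov`** — under `Definitions`, 1 < L, Markov, a bound M, injective one-step maps, `hrg` and (C) on a box ]0, γ_U]: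
   `hTu ⟺ ∃ x₁ ∈ ]0, γ_U], ∃ 0 < b ≤ b′, BetaLowerH b x₁ S.β ∧ BetaUpperH b′ x₁ S.β` (⟹: part 2's `letters_of_uniformTheorem2_markov`, constants (β ln L, β′ ln L);
   ⟸: §7 on the box x₁).  So in this regime the uniform-constant Theorem 2 is EXACTLY the AF letter `BetaAFH` dressed with (U); the typed Theorem 2 is strictly
   weaker (`…PointwiseSizeWitness.typed_theorem2_not_uniform`) and carries the sign (`…Pointwise.betaSignH_of_theorem2_markov`).
§9 `uniformTheorem2_iff_afLetters_lastVarLipschitz` — the same iff with injectivity and `hrg` supplied by row an4 ∕ I1's `LastVarLipschitz S.β C γ_U` (Cγ_U³ < 2) and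
   (U) `BetaUpperH b′ γ_U` (b′γ_U² < 1): inputs `StandingHypotheses`, `Definitions`, Markov, `LastVarLipschitz`, (U), (C).
NOT CLAIMED: any letter for Bałaban's β; which reading print intends; Theorem 2; `BetaPertH`; continuum; Clay.
-/

namespace Summit.QuantumFields.BalabanUV.Beta.EriceFlowEnclosureB12AsPrintedPointwiseUniformIff

open Literature.MathematicalPhysics.QuantumFieldTheory.Balaban1983to89
open Literature.MathematicalPhysics.QuantumFieldTheory.Balaban1983to89.B12BetaAsPrinted
open Literature.MathematicalPhysics.QuantumFieldTheory.Balaban1983to89.FlowStep (prefixOf Box mem_box box_mono BetaContH BetaLowerH BetaUpperH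
  BetaSignH BetaAFH RGEqH couplingTrajectory_exists_hist)
open Literature.MathematicalPhysics.QuantumFieldTheory.Balaban1983to89.BetaDerivClause (LastVarLipschitz)
open Summit.QuantumFields.BalabanUV.Beta.EriceFlowEnclosureB12AsPrintedPointwise (injOn_of_lastVarLipschitz)
open Summit.QuantumFields.BalabanUV.Beta.EriceFlowEnclosureB12AsPrintedPointwiseUniform (letters_of_uniformTheorem2_markov theorem2Statement_of_uniform)
open Summit.QuantumFields.BalabanUV.Beta.EriceFlowEnclosureB12AsPrintedPointwiseWitness (cpl_eq_of_rgEqH)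

noncomputable section

variable {S : Setting}

/-! ## §7 The letters give the g-UNIFORM form (and the typed one) with the same constants -/

/-- **(AF)+(U)+(C) + THE PRINTED `Definitions` ⟹ (0.31) WITH g-UNIFORM CONSTANTS, AND THEOREM 2 AS TYPED.**  If β_{k+1} is jointly continuous on the boxes ]0, γ₀]^{k+1}
with `0 < b ≤ β_{k+1} ≤ b′` there, then for every m: with γ₀, and for γ ≤ γ₀ with g₁ := γ, β := b∕ln L, β′ := b′∕ln L (ONE pair for all g), every g ∈ ]0, γ] and every K
admit a bare coupling g₀ whose run (K, m, g₀) lies in ]0, γ], ends at g and satisfies `Step.Discrete031 b b′ K g g_·` — prover 1's shooting trajectory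
(`FlowStep.couplingTrajectory_exists_hist`) IS the setting's run from its bare end (`cpl_eq_of_rgEqH`: (0.18) + (0.20)'s forward determination).  The typed
`Theorem2Statement` follows (`theorem2Statement_of_uniform`; cf. prover 1's `theorem2Statement_of_letters`, whose proof `FlowStep.B12Thm2Shape_of_betaBoundsH`
chooses the same constants).  A REDUCTION under unprinted letters. [cite: Balaban1987RG1, Thm 2 (0.31) p.259 with (0.18)–(0.20) pp.255–256] -/
theorem uniformTheorem2_of_letters (hD : Definitions S) (hL : Odd S.L ∧ 1 < S.L) {γ₀ b b' : ℝ} (hγ₀ : 0 < γ₀) (hb : 0 < b) (hbb' : b ≤ b')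
    (hcont : BetaContH γ₀ S.β) (hlo : BetaLowerH b γ₀ S.β) (hup : BetaUpperH b' γ₀ S.β) :
    (∀ m : ℕ, ∃ γ₁ : ℝ, 0 < γ₁ ∧ ∀ γ : ℝ, 0 < γ → γ ≤ γ₁ → ∃ g₁ : ℝ, 0 < g₁ ∧ ∃ β β' : ℝ, 0 < β ∧ β ≤ β' ∧
      ∀ g : ℝ, 0 < g → g ≤ g₁ → ∀ K : ℕ, ∃ g₀ : ℝ, Step.InInterval γ K (S.cpl ⟨K, m, g₀⟩) ∧ S.cpl ⟨K, m, g₀⟩ K = g ∧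
        Step.Discrete031 (β * Real.log S.L) (β' * Real.log S.L) K g (S.cpl ⟨K, m, g₀⟩)) ∧ Theorem2Statement S hL := by
  have hlog : 0 < Real.log (S.L : ℝ) := Real.log_pos (by exact_mod_cast hL.2)
  have hTu : ∀ m : ℕ, ∃ γ₁ : ℝ, 0 < γ₁ ∧ ∀ γ : ℝ, 0 < γ → γ ≤ γ₁ → ∃ g₁ : ℝ, 0 < g₁ ∧ ∃ β β' : ℝ, 0 < β ∧ β ≤ β' ∧
      ∀ g : ℝ, 0 < g → g ≤ g₁ → ∀ K : ℕ, ∃ g₀ : ℝ, Step.InInterval γ K (S.cpl ⟨K, m, g₀⟩) ∧ S.cpl ⟨K, m, g₀⟩ K = g ∧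
        Step.Discrete031 (β * Real.log S.L) (β' * Real.log S.L) K g (S.cpl ⟨K, m, g₀⟩) := by
    intro m
    refine ⟨γ₀, hγ₀, fun γ hγ hγle => ⟨γ, hγ, b / Real.log S.L, b' / Real.log S.L, div_pos hb hlog,
      div_le_div_of_nonneg_right hbb' hlog.le, fun g hg hgle K => ?_⟩⟩
    have hcont' : BetaContH γ S.β := fun k => (hcont k).mono (box_mono hγle k)
    have hlo' : BetaLowerH b γ S.β := fun k v hv => hlo k v (box_mono hγle k hv)
    have hup' : BetaUpperH b' γ S.β := fun k v hv => hup k v (box_mono hγle k hv)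
    obtain ⟨gs, hend, hrg, hI, hDisc, -⟩ := couplingTrajectory_exists_hist S.β hγ hb.le hbb' hcont' hlo' hup' K g hg hgle
    have heq := cpl_eq_of_rgEqH hD (m := m) hrg fun k hk => (hI k hk).1
    refine ⟨gs 0, fun k hk => by rw [heq k hk]; exact hI k hk, by rw [heq K le_rfl]; exact hend, ?_⟩
    rw [div_mul_cancel₀ _ hlog.ne', div_mul_cancel₀ _ hlog.ne']
    intro k hk
    rw [heq k hk]
    exact hDisc k hk
  exact ⟨hTu, theorem2Statement_of_uniform hTu⟩

/-! ## §8 The iff: uniform-constant Theorem 2 ⟺ the AF letter with (U), in the Markov + injective regime -/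

/-- **IN THE MARKOV READING WITH INJECTIVE ONE-STEP MAPS, [I] THEOREM 2 WITH g-UNIFORM CONSTANTS ⟺ «∃ box ]0, x₁] with 0 < b ≤ β_{k+1} ≤ b′ for all k».**
Standing letters: the printed `Definitions`, 1 < L, Markov `hM`, a bound M on ]0, γ_U], injectivity of every x ↦ 1∕x² − β_{k+1}(x) on ]0, γ_U], `hrg` on ]0, γ_U], (C) on
]0, γ_U]^{k+1}.  (⟹) part 2's `letters_of_uniformTheorem2_markov` with (b, b′) = (β ln L, β′ ln L); (⟸) §7 on the box x₁ ((C) restricted).  So here `FlowStep` §5's STRONG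
located input `BetaAFH` (with (U)) is not a «convenient sufficient form» but the EXACT CONTENT of the uniform-constant Theorem 2; the typed Theorem 2 carries only the
sign (`…Pointwise.betaSignH_of_theorem2_markov`, `…PointwiseSizeWitness.typed_theorem2_not_uniform`). [cite: Balaban1987RG1, Thm 2 (0.31) p.259 with (0.18)–(0.20) pp.255–256 and p.264] -/
theorem uniformTheorem2_iff_afLetters_markov (hD : Definitions S) (hL : Odd S.L ∧ 1 < S.L)
    (hM : ∀ (k : ℕ) (p q : Fin (k + 1) → ℝ), p (Fin.last k) = q (Fin.last k) → S.β k p = S.β k q) {γU M : ℝ} (hγU : 0 < γU)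
    (hub : ∀ (k : ℕ) (x : ℝ), 0 < x → x ≤ γU → S.β k (fun _ => x) ≤ M)
    (hinj : ∀ k : ℕ, Set.InjOn (fun x : ℝ => 1 / x ^ 2 - S.β k (fun _ => x)) (Set.Ioc 0 γU))
    (hrg : ∀ P : B12.RunParams, Step.InInterval γU P.K (S.cpl P) → RGEqH P.K S.β (S.cpl P)) (hcont : BetaContH γU S.β) :
    (∀ m : ℕ, ∃ γ₀ : ℝ, 0 < γ₀ ∧ ∀ γ : ℝ, 0 < γ → γ ≤ γ₀ → ∃ g₁ : ℝ, 0 < g₁ ∧ ∃ β β' : ℝ, 0 < β ∧ β ≤ β' ∧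
      ∀ g : ℝ, 0 < g → g ≤ g₁ → ∀ K : ℕ, ∃ g₀ : ℝ, Step.InInterval γ K (S.cpl ⟨K, m, g₀⟩) ∧ S.cpl ⟨K, m, g₀⟩ K = g ∧
        Step.Discrete031 (β * Real.log S.L) (β' * Real.log S.L) K g (S.cpl ⟨K, m, g₀⟩)) ↔
      ∃ x₁ b b' : ℝ, 0 < x₁ ∧ x₁ ≤ γU ∧ 0 < b ∧ b ≤ b' ∧ BetaLowerH b x₁ S.β ∧ BetaUpperH b' x₁ S.β := by
  have hlog : 0 < Real.log (S.L : ℝ) := Real.log_pos (by exact_mod_cast hL.2)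
  constructor
  · intro hTu
    obtain ⟨x₁, β, β', hx₁, hx₁U, hβ, hββ', hlo, hhi⟩ := letters_of_uniformTheorem2_markov hTu hM hγU hub hinj hrg
    exact ⟨x₁, β * Real.log S.L, β' * Real.log S.L, hx₁, hx₁U, mul_pos hβ hlog, mul_le_mul_of_nonneg_right hββ' hlog.le, hlo, hhi⟩
  · rintro ⟨x₁, b, b', hx₁, hx₁U, hb, hbb', hlo, hhi⟩
    exact (uniformTheorem2_of_letters hD hL hx₁ hb hbb' (fun k => (hcont k).mono (box_mono hx₁U k)) hlo hhi).1

/-! ## §9 The same iff with row U's modulus as the structural input -/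

/-- **… WITH ROW an4 ∕ I1's `LastVarLipschitz` AND (U) AS THE ONLY STRUCTURAL INPUTS**: `StandingHypotheses` + `Definitions` + Markov + `LastVarLipschitz S.β C γ_U` (Cγ_U³ < 2,
row U's smallness — sign-free injectivity, part 1) + (U) `BetaUpperH b′ γ_U S.β` (b′γ_U² < 1 — prover 1's `hrg_of_betaUpperH`) + (C) on ]0, γ_U]^{k+1} ⟹ the iff of §8.
[cite: Balaban1987RG1, Thm 2 (0.31) p.259 with (0.20) p.256 and p.264] -/
theorem uniformTheorem2_iff_afLetters_lastVarLipschitz (hH : StandingHypotheses S) (hD : Definitions S)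
    (hM : ∀ (k : ℕ) (p q : Fin (k + 1) → ℝ), p (Fin.last k) = q (Fin.last k) → S.β k p = S.β k q) {C γU b' : ℝ} (hγU : 0 < γU)
    (hLip : LastVarLipschitz S.β C γU) (hC : C * γU ^ 3 < 2) (hup : BetaUpperH b' γU S.β) (hsmall : b' * γU ^ 2 < 1) (hcont : BetaContH γU S.β) :
    (∀ m : ℕ, ∃ γ₀ : ℝ, 0 < γ₀ ∧ ∀ γ : ℝ, 0 < γ → γ ≤ γ₀ → ∃ g₁ : ℝ, 0 < g₁ ∧ ∃ β β' : ℝ, 0 < β ∧ β ≤ β' ∧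
      ∀ g : ℝ, 0 < g → g ≤ g₁ → ∀ K : ℕ, ∃ g₀ : ℝ, Step.InInterval γ K (S.cpl ⟨K, m, g₀⟩) ∧ S.cpl ⟨K, m, g₀⟩ K = g ∧
        Step.Discrete031 (β * Real.log S.L) (β' * Real.log S.L) K g (S.cpl ⟨K, m, g₀⟩)) ↔
      ∃ x₁ b b'' : ℝ, 0 < x₁ ∧ x₁ ≤ γU ∧ 0 < b ∧ b ≤ b'' ∧ BetaLowerH b x₁ S.β ∧ BetaUpperH b'' x₁ S.β :=
  uniformTheorem2_iff_afLetters_markov hD (hL_of_standing hH) hM hγU (M := b')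
    (fun k x hx hxle => hup k (fun _ => x) (mem_box.2 fun _ => ⟨hx, hxle⟩)) (injOn_of_lastVarLipschitz hM hγU hLip hC)
    (EriceFlowEnclosureB12AsPrintedTunedUpper.hrg_of_betaUpperH hD hγU hup hsmall) hcont

end

end Summit.QuantumFields.BalabanUV.Beta.EriceFlowEnclosureB12AsPrintedPointwiseUniformIff
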